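import Literature.AlgebraicGeometry.Resolution.BlowupCharts
import Literature.AlgebraicGeometry.Motives.CyclesBirationalLiftProofs
import Mathlib.AlgebraicGeometry.Morphisms.ClosedImmersion
import Mathlib.AlgebraicGeometry.ResidueField
import HarnessLib

/-!
# Blowing up a two-generated ideal: the locus `t/b = 0` maps with trivial residue fields

Fulton, *Intersection Theory*, proof of Lemma 2.4 (p. 37): for the blow-up `π : X̃ → X` of a
variety along `D ∩ D' = V(a, a')`, "`X̃ ⊂ X × ℙ¹` … `C ⊂ X × {0}` and `C' ⊂ X × {∞}` map
isomorphically by `π` into subschemes of `D` and `D'`", where `π^*D = E + C`. This file proves the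
consequence of that remark which the proof of Lemma 2.4 (b) uses, in chart form and for an
arbitrary blow-up (universal property, `IsBlowup`, `Resolution/Blowups`) of an arbitrary scheme
along an ideal sheaf `J` which is generated by two sections `t, t'` on an affine open `W`:

* `blowupAlgebra_two_generators` — in the affine blowup algebra `A[I/b]` of `I = (t, t')` at
  `b = α t + β t' ∈ I` (`Resolution/AffineBlowupAlgebra`): the elements `u = t/b`, `u' = t'/b`
  with `u b = t`, `u' b = t'`, `α u + β u' = 1`, and **every element `y` of `A[I/b]` satisfies
  `βⁿ y ≡ a (mod u)` for some `n` and `a ∈ A`** (so `A[I/b]/(u)` is a quotient of `A[1/β]`);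
* `residueFieldMap_SpecMap_surjective_of_forall_pow_mul_sub_mem` — for a ring map `ψ : A → B`,
  `u ∈ B` and `β ∈ A` with `ψ β` a unit modulo `u` and `∀ y, ∃ n a, ψ(β)ⁿ y - ψ a ∈ (u)`, the
  residue field maps of `Spec ψ` at the primes containing `u` are surjective (`Spec B/(u) → Spec A`
  factors as a closed immersion into `Spec A[1/β]` followed by an open immersion, hence is
  surjective on stalks);
* `IsBlowup.exists_affine_residueFieldMap_surjective` — **for a blow-up `π : X' → X` along `J`
  with `J(W) = (t, t')` on an affine open `W`, every point over `W` has an affine neighbourhood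
  `V` with sections `u, e ∈ Γ(X', V)` such that `π^* t = u e`, `(J·𝒪_{X'})(V) = (e)` with `e`
  regular, and `κ(π y) → κ(y)` is surjective at every `y ∈ V` with `u(y) = 0`.** (With `e` a local
  equation of the exceptional divisor and `u` one of `C = π^*D - E` when `J = 𝒪(-D) + 𝒪(-D')`,
  `t` a local equation of `D`: the points of `|C|` have trivial residue field extensions over `X`.)

Everything is proved; no named facts.

## References

* W. Fulton, *Intersection Theory*, 2nd ed., Springer 1998, Lemma 2.4 and its proof (p. 37).
  [Fulton1998]
* The Stacks Project, Tag 0804 (charts of a blowing up), Tag 052Q (affine blowup algebras).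
  [StacksProject]
-/

noncomputable section

universe u

open CategoryTheory AlgebraicGeometry TopologicalSpace IsLocalization

namespace Literature.AlgebraicGeometry.Motives

open Literature.AlgebraicGeometry.Resolution

/-! ### The affine blowup algebra of a two-generated ideal -/

section Algebra

variable {R : Type u} [CommRing R]

/-- **`A[I/b]` for `I = (t, t')` and `b = α t + β t'`**: the elements `u = t/b`, `u' = t'/b` satisfy
`u b = t`, `u' b = t'`, `α u + β u' = 1`, and every `y ∈ A[I/b]` satisfies `βⁿ y - a ∈ (u)` for some
`n : ℕ`, `a ∈ A` (as `A[I/b]` is generated by the `x/b = λ u + μ u'`, `x = λ t + μ t' ∈ I`, and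
`β (λ u + μ u') - μ = (β λ - μ α) u`). [cite: StacksProject, Tag 052Q] -/
theorem blowupAlgebra_two_generators {t t' b α β : R} (hb : α * t + β * t' = b) :
    ∃ u u' : blowupAlgebra (Ideal.span {t, t'}) b,
      (u : Localization.Away b) * algebraMap R _ b = algebraMap R _ t ∧
      (u' : Localization.Away b) * algebraMap R _ b = algebraMap R _ t' ∧
      algebraMap R _ α * u + algebraMap R _ β * u' = 1 ∧
      ∀ y : blowupAlgebra (Ideal.span {t, t'}) b, ∃ (n : ℕ) (a : R),
        algebraMap R _ β ^ n * y - algebraMap R _ a ∈ Ideal.span {u} := by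
  set I : Ideal R := Ideal.span {t, t'} with hI
  set L := Localization.Away b with hL
  have htI : t ∈ I := Ideal.subset_span (Set.mem_insert _ _)
  have ht'I : t' ∈ I := Ideal.subset_span (Set.mem_insert_of_mem _ rfl)
  let u : blowupAlgebra I b := ⟨_, div_mem_blowupAlgebra I b htI⟩
  let u' : blowupAlgebra I b := ⟨_, div_mem_blowupAlgebra I b ht'I⟩
  have hu : (u : L) * algebraMap R L b = algebraMap R L t := div_mul_algebraMap b t
  have hu' : (u' : L) * algebraMap R L b = algebraMap R L t' := div_mul_algebraMap b t'
  -- `α u + β u' = (α t + β t')/b = 1`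
  have hone : algebraMap R (blowupAlgebra I b) α * u + algebraMap R (blowupAlgebra I b) β * u' = 1 := by
    apply Subtype.ext
    change algebraMap R L α * (algebraMap R L t * Away.invSelf b) +
      algebraMap R L β * (algebraMap R L t' * Away.invSelf b) = 1
    rw [← mul_assoc, ← mul_assoc, ← add_mul, ← map_mul, ← map_mul, ← map_add, hb]
    exact Away.mul_invSelf b
  refine ⟨u, u', hu, hu', hone, ?_⟩
  -- generation: induction over `A[I/b] = A[x/b : x ∈ I]`
  rintro ⟨y, hy⟩
  induction hy using Algebra.adjoin_induction with
  | mem x hx =>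
    obtain ⟨z, hz, rfl⟩ := hx
    obtain ⟨l, m, rfl⟩ := Ideal.mem_span_pair.mp hz
    refine ⟨1, m, ?_⟩
    -- `x/b = l u + m u'`, `β (l u + m u') - m = (β l - m α) u`
    have hx : (⟨algebraMap R L (l * t + m * t') * Away.invSelf b,
        div_mem_blowupAlgebra I b hz⟩ : blowupAlgebra I b) =
        algebraMap R _ l * u + algebraMap R _ m * u' := by
      apply Subtype.ext
      change algebraMap R L (l * t + m * t') * Away.invSelf b =
        algebraMap R L l * (algebraMap R L t * Away.invSelf b) +
          algebraMap R L m * (algebraMap R L t' * Away.invSelf b)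
      rw [map_add, map_mul, map_mul]
      ring
    rw [hx, pow_one, Ideal.mem_span_singleton']
    refine ⟨algebraMap R _ β * algebraMap R _ l - algebraMap R _ m * algebraMap R _ α, ?_⟩
    have e1 : algebraMap R (blowupAlgebra I b) β * u' = 1 - algebraMap R (blowupAlgebra I b) α * u := by
      rw [← hone]; ring
    linear_combination (-(algebraMap R (blowupAlgebra I b) m)) * e1
  | algebraMap r =>
    refine ⟨0, r, ?_⟩
    rw [pow_zero, one_mul]
    convert (Ideal.span {u}).zero_mem using 1
    exact sub_eq_zero.mpr rfl
  | add x y hx hy ihx ihy =>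
    obtain ⟨n, a, ha⟩ := ihx
    obtain ⟨m, a', ha'⟩ := ihy
    refine ⟨n + m, β ^ m * a + β ^ n * a', ?_⟩
    have key : algebraMap R (blowupAlgebra I b) β ^ (n + m) * (⟨x + y, add_mem hx hy⟩ : blowupAlgebra I b) -
        algebraMap R _ (β ^ m * a + β ^ n * a') =
        algebraMap R _ β ^ m * (algebraMap R _ β ^ n * ⟨x, hx⟩ - algebraMap R _ a) +
          algebraMap R _ β ^ n * (algebraMap R _ β ^ m * ⟨y, hy⟩ - algebraMap R _ a') := by
      have : (⟨x + y, add_mem hx hy⟩ : blowupAlgebra I b) = ⟨x, hx⟩ + ⟨y, hy⟩ := rfl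
      rw [this, map_add, map_mul, map_mul, map_pow, map_pow, pow_add]
      ring
    rw [key]
    exact (Ideal.span {u}).add_mem (Ideal.mul_mem_left _ _ ha) (Ideal.mul_mem_left _ _ ha')
  | mul x y hx hy ihx ihy =>
    obtain ⟨n, a, ha⟩ := ihx
    obtain ⟨m, a', ha'⟩ := ihy
    refine ⟨n + m, a * a', ?_⟩
    have key : algebraMap R (blowupAlgebra I b) β ^ (n + m) * (⟨x * y, mul_mem hx hy⟩ : blowupAlgebra I b) -
        algebraMap R _ (a * a') =
        algebraMap R _ β ^ m * ⟨y, hy⟩ * (algebraMap R _ β ^ n * ⟨x, hx⟩ - algebraMap R _ a) +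
          algebraMap R _ a * (algebraMap R _ β ^ m * ⟨y, hy⟩ - algebraMap R _ a') := by
      have : (⟨x * y, mul_mem hx hy⟩ : blowupAlgebra I b) = ⟨x, hx⟩ * ⟨y, hy⟩ := rfl
      rw [this, map_mul, pow_add]
      ring
    rw [key]
    exact (Ideal.span {u}).add_mem (Ideal.mul_mem_left _ _ ha) (Ideal.mul_mem_left _ _ ha')

end Algebra

/-! ### Residue fields of `Spec B → Spec A` at the primes containing `u` -/

section Spec

/-- A morphism which is surjective on the stalk at `x` is surjective on the residue field at `x`.
[folklore] -/
theorem residueFieldMap_surjective_of_stalkMap_surjective {X Y : Scheme.{u}} (f : X ⟶ Y) (x : X)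
    (h : Function.Surjective (f.stalkMap x)) : Function.Surjective (f.residueFieldMap x) := by
  intro r
  obtain ⟨s, rfl⟩ := X.residue_surjective x r
  obtain ⟨s', rfl⟩ := h s
  refine ⟨Y.residue _ s', ?_⟩
  change (Y.residue _ ≫ f.residueFieldMap x) s' = (f.stalkMap x ≫ X.residue x) s'
  rw [Scheme.residue_residueFieldMap]

variable {A B : Type u} [CommRing A] [CommRing B]

/-- **Residue fields of `Spec B → Spec A` at the primes over `u = 0`, when `B/(u)` is a quotient
of `A[1/β]`**: if `ψ β` is a unit modulo `u` (`ψ(β) v = 1 + w u`) and every `y ∈ B` has `ψ(β)ⁿ y - ψ a ∈ (u)` for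
some `n`, `a`, then `κ(ψ⁻¹ P) → κ(P)` is surjective for every prime `P ∋ u` of `B`: the composite
`Spec B/(u) → Spec B → Spec A` is `Spec B/(u) → Spec A[1/β] → Spec A`, a closed immersion followed by
an open immersion, hence surjective on stalks. [folklore] -/
theorem residueFieldMap_SpecMap_surjective_of_forall_pow_mul_sub_mem (ψ : A →+* B) (u : B) (β : A)
    (hunit : ∃ v w : B, ψ β * v = 1 + w * u)
    (hgen : ∀ y : B, ∃ (n : ℕ) (a : A), ψ β ^ n * y - ψ a ∈ Ideal.span {u})
    (P : PrimeSpectrum B) (huP : u ∈ P.asIdeal) :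
    Function.Surjective ((Spec.map (CommRingCat.ofHom ψ)).residueFieldMap P) := by
  -- `ψ β` is a unit modulo `u`
  replace hunit : IsUnit (Ideal.Quotient.mk (Ideal.span {u}) (ψ β)) := by
    obtain ⟨v, w, hv⟩ := hunit
    refine IsUnit.of_mul_eq_one (Ideal.Quotient.mk (Ideal.span {u}) v) ?_
    rw [← map_mul, hv, map_add, map_one, map_mul,
      Ideal.Quotient.eq_zero_iff_mem.mpr (Ideal.mem_span_singleton_self u), mul_zero, add_zero]
  -- `A[1/β] → B/(u)` through which `A → B → B/(u)` factors; it is surjective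
  obtain ⟨lam, hlam⟩ : ∃ lam : Localization.Away β →+* B ⧸ Ideal.span {u},
      lam.comp (algebraMap A (Localization.Away β)) = (Ideal.Quotient.mk (Ideal.span {u})).comp ψ :=
    ⟨IsLocalization.Away.lift β hunit, IsLocalization.Away.lift_comp β hunit⟩
  have hlam_apply : ∀ a : A, lam (algebraMap A _ a) = Ideal.Quotient.mk _ (ψ a) := fun a =>
    congr($hlam a)
  have hlam_surj : Function.Surjective lam := by
    intro w
    obtain ⟨y, rfl⟩ := Ideal.Quotient.mk_surjective w
    obtain ⟨n, a, ha⟩ := hgen y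
    have key : Ideal.Quotient.mk (Ideal.span {u}) (ψ a) =
        Ideal.Quotient.mk (Ideal.span {u}) (ψ β) ^ n * Ideal.Quotient.mk (Ideal.span {u}) y := by
      rw [← map_pow, ← map_mul, eq_comm, ← sub_eq_zero, ← map_sub]
      exact Ideal.Quotient.eq_zero_iff_mem.mpr ha
    -- the inverse of `β` in `B/(u)` comes from `1/β ∈ A[1/β]`
    have hv : lam (IsLocalization.Away.invSelf β) * Ideal.Quotient.mk (Ideal.span {u}) (ψ β) = 1 := by
      rw [← hlam_apply, ← map_mul, mul_comm, IsLocalization.Away.mul_invSelf, map_one]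
    refine ⟨algebraMap A _ a * IsLocalization.Away.invSelf β ^ n, ?_⟩
    rw [map_mul, map_pow, hlam_apply, key, mul_assoc, mul_comm (Ideal.Quotient.mk _ y), ← mul_assoc,
      ← mul_pow, mul_comm (Ideal.Quotient.mk _ (ψ β)), hv, one_pow, one_mul]
  -- the schemes: `Spec B/(u) → Spec B → Spec A` is `Spec B/(u) → Spec A[1/β] → Spec A`
  have hcomp : Spec.map (CommRingCat.ofHom (Ideal.Quotient.mk (Ideal.span {u}))) ≫
      Spec.map (CommRingCat.ofHom ψ) =
        Spec.map (CommRingCat.ofHom lam) ≫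
          Spec.map (CommRingCat.ofHom (algebraMap A (Localization.Away β))) := by
    rw [← Spec.map_comp, ← Spec.map_comp, ← CommRingCat.ofHom_comp, ← CommRingCat.ofHom_comp, hlam]
  haveI : IsClosedImmersion (Spec.map (CommRingCat.ofHom lam)) :=
    IsClosedImmersion.spec_of_surjective _ hlam_surj
  haveI : IsOpenImmersion (Spec.map (CommRingCat.ofHom (algebraMap A (Localization.Away β)))) :=
    IsOpenImmersion.of_isLocalization β
  -- the point of `Spec B/(u)` over `P`
  have hker : RingHom.ker (Ideal.Quotient.mk (Ideal.span {u})) ≤ P.asIdeal := by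
    rw [Ideal.mk_ker, Ideal.span_le, Set.singleton_subset_iff]
    exact huP
  obtain ⟨Pbar, hPbar⟩ : ∃ Pbar : PrimeSpectrum (B ⧸ Ideal.span {u}),
      (Spec.map (CommRingCat.ofHom (Ideal.Quotient.mk (Ideal.span {u})))).base Pbar = P := by
    refine ⟨⟨P.asIdeal.map (Ideal.Quotient.mk (Ideal.span {u})),
      Ideal.map_isPrime_of_surjective Ideal.Quotient.mk_surjective hker⟩, ?_⟩
    rw [Spec.map_base]
    change PrimeSpectrum.comap (Ideal.Quotient.mk (Ideal.span {u})) _ = P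
    ext1
    change (P.asIdeal.map (Ideal.Quotient.mk (Ideal.span {u}))).comap
      (Ideal.Quotient.mk (Ideal.span {u})) = P.asIdeal
    rw [Ideal.comap_map_of_surjective _ Ideal.Quotient.mk_surjective, sup_eq_left,
      ← RingHom.ker_eq_comap_bot]
    exact hker
  have hsurj : Function.Surjective
      ((Spec.map (CommRingCat.ofHom (Ideal.Quotient.mk (Ideal.span {u}))) ≫
        Spec.map (CommRingCat.ofHom ψ)).residueFieldMap Pbar) := by
    rw [hcomp]
    exact residueFieldMap_surjective_of_stalkMap_surjective _ _ (Scheme.Hom.stalkMap_surjective _ _)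
  have h := residueFieldMap_surjective_of_comp
    (Spec.map (CommRingCat.ofHom (Ideal.Quotient.mk (Ideal.span {u})))) (Spec.map (CommRingCat.ofHom ψ))
    Pbar hsurj
  subst hPbar
  exact h

end Spec

/-! ### Blow-ups along a two-generated ideal sheaf -/

section Blowup

variable {X' X : Scheme.{u}} {π : X' ⟶ X} {J : X.IdealSheafData}

/-- Charts of a blow-up on sections over a GIVEN affine open `U ∋ π x'` (the variant of
`IsBlowup.exists_chart` of `Resolution/BlowupCharts` keeping `U`): affine `x' ∈ V ⊆ π⁻¹ U`,
`b ∈ J(U)` and `e : Γ(X', V) ≅ Γ(X, U)[J(U)/b]` with `e ∘ π^* = (Γ(X, U) → Γ(X, U)[J(U)/b])`.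
A `private` copy of `IsBlowup.exists_chart_of_mem` of
`Resolution/CoefficientIdealRestrictionPersistence` (same ten-line proof), whose imports (the
resolution-of-singularities development) are unrelated to cycles. [cite: StacksProject, Tag 0804] -/
private theorem exists_chart_of_mem' (hπ : IsBlowup π J) (U : X.affineOpens) {x' : X'}
    (hxU : π x' ∈ (U : X.Opens)) :
    ∃ (V : X'.affineOpens) (hVU : (V : X'.Opens) ≤ π ⁻¹ᵁ (U : X.Opens))
      (b : Γ(X, U)) (_ : b ∈ J.ideal U) (e : Γ(X', V) ≃+* blowupAlgebra (J.ideal U) b),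
      x' ∈ (V : X'.Opens) ∧
        e.toRingHom.comp (π.appLE U V hVU).hom =
          algebraMap Γ(X, U) (blowupAlgebra (J.ideal U) b) := by
  obtain ⟨b, hb, g, hg, hx', hgπ⟩ := hπ.exists_blowupAlgebra_chart_of_mem U hxU
  haveI := hg
  have hVU := image_top_le_preimage_of_comp_eq π g U _ hgπ
  have key := appLE_appIso_ΓSpecIso_of_comp_eq π g U _ hgπ hVU
  refine ⟨⟨g ''ᵁ ⊤, (isAffineOpen_top _).image_of_isOpenImmersion g⟩, hVU, b, hb,
    ((g.appIso ⊤) ≪≫ Scheme.ΓSpecIso _).commRingCatIsoToRingEquiv, ?_, ?_⟩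
  · obtain ⟨z, rfl⟩ := hx'
    exact ⟨z, trivial, rfl⟩
  · have key' := congrArg CommRingCat.Hom.hom key
    rw [CommRingCat.hom_comp, CommRingCat.hom_ofHom] at key'
    exact key'

/-- A point of an affine open `V` lies in `X_s`, `s ∈ Γ(X, V)`, iff `s` is not in its prime ideal of
`Γ(X, V)`. [folklore] -/
theorem mem_basicOpen_iff_notMem_primeIdealOf {Y : Scheme.{u}} {V : Y.Opens} (hV : IsAffineOpen V)
    (s : Γ(Y, V)) (y : V) : (y : Y) ∈ Y.basicOpen s ↔ s ∉ (hV.primeIdealOf y).asIdeal := by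
  have h1 : (y : Y) ∈ Y.basicOpen s ↔ hV.primeIdealOf y ∈ hV.fromSpec ⁻¹ᵁ Y.basicOpen s := by
    change _ ↔ hV.fromSpec (hV.primeIdealOf y) ∈ Y.basicOpen s
    rw [hV.fromSpec_primeIdealOf]
  rw [h1, hV.fromSpec_preimage_basicOpen]
  exact PrimeSpectrum.mem_basicOpen (f := s) (x := hV.primeIdealOf y)

/-- **Points of a blow-up where `t/b` vanishes have trivial residue field extensions.** Let
`π : X' → X` be a blow-up along `J` and `W ⊆ X` an affine open with `J(W) = (t, t')`. Every point
over `W` has an affine neighbourhood `V ⊆ π⁻¹ W` with sections `u, e ∈ Γ(X', V)` such that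
`π^* t = u · e`, `(J·𝒪_{X'})(V) = (e)`, `e` is a non-zero-divisor, and **`κ(π y) → κ(y)` is
surjective for every `y ∈ V` with `y ∉ X'_u`** (Fulton, proof of Lemma 2.4: "`C ⊂ X × {0}` … map[s]
isomorphically by `π` into subschemes of `D`"; here via the chart `Γ(X', V) ≅ Γ(X, W)[J(W)/b]`,
in which `e = b`, `u = t/b`, and `Γ/(u)` is a quotient of `Γ(X, W)[1/β]`, `b = α t + β t'`).
[cite: Fulton1998, Lemma 2.4 (proof, p. 37)] -/
theorem _root_.Literature.AlgebraicGeometry.Resolution.IsBlowup.exists_affine_residueFieldMap_surjective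
    (hπ : IsBlowup π J) (W : X.affineOpens)
    {t t' : Γ(X, W)} (hJ : J.ideal W = Ideal.span {t, t'}) {x : X'} (hxW : π x ∈ (W : X.Opens)) :
    ∃ (V : X'.affineOpens) (hVW : (V : X'.Opens) ≤ π ⁻¹ᵁ (W : X.Opens)) (u e : Γ(X', V)),
      x ∈ (V : X'.Opens) ∧
      π.appLE W V hVW t = u * e ∧
      (J.comap π).ideal V = Ideal.span {e} ∧ e ∈ nonZeroDivisors Γ(X', V) ∧
      ∀ y : X', ∀ hy : y ∈ (V : X'.Opens), y ∉ X'.basicOpen u →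
        Function.Surjective (π.residueFieldMap y) := by
  obtain ⟨V, hVW, b, hb, eqv, hxV, hcomp⟩ := exists_chart_of_mem' hπ W hxW
  -- rewrite `J(W)` as `(t, t')` in the type of the chart isomorphism
  revert hcomp eqv hb
  rw [hJ]
  intro hb eqv hcomp
  obtain ⟨α, β, hαβ⟩ := Ideal.mem_span_pair.mp hb
  obtain ⟨uB, u'B, huB, -, hone, hgen⟩ := blowupAlgebra_two_generators hαβ
  -- `π^* : Γ(X, W) → Γ(X', V)`, and `θ : Γ(X', V) ≅ Γ(X, W)[(t, t')/b] ⊆ Γ(X, W)[1/b]`; we compute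
  -- in the localisation `Γ(X, W)[1/b]`
  obtain ⟨ψ, hψ⟩ : ∃ ψ : Γ(X, W) →+* Γ(X', V), ψ = (π.appLE W V hVW).hom := ⟨_, rfl⟩
  set L := Localization.Away b with hL
  obtain ⟨θ, hθ⟩ : ∃ θ : Γ(X', V) →+* L,
      θ = (blowupAlgebra (Ideal.span {t, t'}) b).val.toRingHom.comp eqv.toRingHom := ⟨_, rfl⟩
  have hθapply : ∀ z, θ z = (eqv z : L) := fun z => by rw [hθ]; rfl
  have hθinj : Function.Injective θ := fun z z' h => eqv.injective (Subtype.ext (by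
    rwa [hθapply, hθapply] at h))
  have hθsymm : ∀ w : blowupAlgebra (Ideal.span {t, t'}) b, θ (eqv.symm w) = (w : L) := fun w => by
    rw [hθapply, RingEquiv.apply_symm_apply]
  have hθψ : ∀ a, θ (ψ a) = algebraMap Γ(X, W) L a := fun a => by
    have e1 : eqv (ψ a) = algebraMap Γ(X, W) (blowupAlgebra (Ideal.span {t, t'}) b) a := by
      rw [← hcomp, hψ]; rfl
    rw [hθapply, e1]
    rfl
  -- the relations `α u + β u' = 1` and `βⁿ y - a = c u` in `Γ(X, W)[1/b]`
  have hone' : algebraMap _ L α * (uB : L) + algebraMap _ L β * (u'B : L) = 1 := by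
    have := congrArg Subtype.val hone
    simpa only [Subalgebra.coe_add, Subalgebra.coe_mul, Subalgebra.coe_algebraMap, Subalgebra.coe_one]
      using this
  have hgenL : ∀ y : blowupAlgebra (Ideal.span {t, t'}) b, ∃ (n : ℕ) (a : Γ(X, W))
      (c : blowupAlgebra (Ideal.span {t, t'}) b),
      algebraMap _ L β ^ n * (y : L) - algebraMap _ L a = (c : L) * (uB : L) := by
    intro y
    obtain ⟨n, a, ha⟩ := hgen y
    obtain ⟨c, hc⟩ := Ideal.mem_span_singleton'.mp ha
    refine ⟨n, a, c, ?_⟩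
    have := congrArg Subtype.val hc
    simpa only [Subalgebra.coe_sub, Subalgebra.coe_mul, Subalgebra.coe_pow, Subalgebra.coe_algebraMap]
      using this.symm
  refine ⟨V, hVW, eqv.symm uB, ψ b, hxV, ?_, ?_, ?_, ?_⟩
  · -- `π^* t = u e`
    change (π.appLE W V hVW).hom t = eqv.symm uB * ψ b
    rw [← hψ]
    apply hθinj
    rw [RingHom.map_mul θ, hθψ, hθψ, hθsymm]
    exact huB.symm
  · -- `(J · 𝒪_{X'})(V) = (e)`
    rw [ideal_comap_of_le π J W V hVW, hJ, ← hψ]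
    apply le_antisymm
    · rw [Ideal.map_span, Ideal.span_le]
      rintro _ ⟨s, hs, rfl⟩
      rw [SetLike.mem_coe, Ideal.mem_span_singleton']
      have hsB : algebraMap _ L s * Away.invSelf b ∈ blowupAlgebra (Ideal.span {t, t'}) b :=
        div_mem_blowupAlgebra _ b (Ideal.subset_span hs)
      refine ⟨eqv.symm ⟨_, hsB⟩, hθinj ?_⟩
      rw [RingHom.map_mul θ, hθsymm, hθψ, hθψ]
      exact div_mul_algebraMap b s
    · rw [Ideal.span_le, Set.singleton_subset_iff]
      exact Ideal.mem_map_of_mem ψ hb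
  · -- `e` is a non-zero-divisor (`b` is a unit of `Γ(X, W)[1/b]`)
    rw [mem_nonZeroDivisors_iff_right]
    intro y hy
    apply hθinj
    have h1 : θ y * algebraMap _ L b = 0 := by rw [← hθψ, ← RingHom.map_mul θ, hy, RingHom.map_zero θ]
    rw [RingHom.map_zero θ]
    exact (IsLocalization.Away.algebraMap_isUnit (S := L) b).mul_left_eq_zero.mp h1
  · -- residue fields at the points `y ∉ X'_u` of `V`
    intro y hy hyu
    have hunit : ∃ v w : Γ(X', V), ψ β * v = 1 + w * eqv.symm uB := by
      refine ⟨eqv.symm u'B, -(ψ α), hθinj ?_⟩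
      rw [RingHom.map_mul θ, RingHom.map_add θ, RingHom.map_mul θ, RingHom.map_neg θ, RingHom.map_one θ,
        hθψ, hθψ, hθsymm, hθsymm]
      linear_combination hone'
    have hgen' : ∀ z : Γ(X', V), ∃ (n : ℕ) (a : Γ(X, W)),
        ψ β ^ n * z - ψ a ∈ Ideal.span {eqv.symm uB} := by
      intro z
      obtain ⟨n, a, c, hc⟩ := hgenL (eqv z)
      refine ⟨n, a, Ideal.mem_span_singleton'.mpr ⟨eqv.symm c, hθinj ?_⟩⟩
      rw [RingHom.map_mul θ, RingHom.map_sub θ, RingHom.map_mul θ, RingHom.map_pow θ, hθψ, hθψ,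
        hθsymm, hθsymm, hθapply]
      exact hc.symm
    -- the prime of `y` in `Γ(X', V)`
    have huP : eqv.symm uB ∈ (V.2.primeIdealOf ⟨y, hy⟩).asIdeal := by
      by_contra h
      exact hyu ((mem_basicOpen_iff_notMem_primeIdealOf V.2 (eqv.symm uB) ⟨y, hy⟩).mpr h)
    have h1 := residueFieldMap_SpecMap_surjective_of_forall_pow_mul_sub_mem ψ (eqv.symm uB) β
      hunit hgen' (V.2.primeIdealOf ⟨y, hy⟩) huP
    -- `Spec Γ(X', V) → X'` is an open immersion onto `V` with `fromSpec ≫ π = Spec π^* ≫ fromSpec`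
    have h2 : Function.Surjective ((V.2.fromSpec ≫ π).residueFieldMap (V.2.primeIdealOf ⟨y, hy⟩)) := by
      rw [← IsAffineOpen.SpecMap_appLE_fromSpec π (W.2 : IsAffineOpen (W : X.Opens))
        (V.2 : IsAffineOpen (V : X'.Opens)) hVW, Scheme.residueFieldMap_comp]
      change Function.Surjective ((Spec.map (π.appLE W V hVW)).residueFieldMap _ ∘
        W.2.fromSpec.residueFieldMap _)
      refine Function.Surjective.comp ?_ ?_
      · have e : Spec.map (π.appLE W V hVW) = Spec.map (CommRingCat.ofHom ψ) := by rw [hψ]; rfl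
        rw [e]
        exact h1
      · exact (ConcreteCategory.bijective_of_isIso (W.2.fromSpec.residueFieldMap _)).2
    have h3 := residueFieldMap_surjective_of_comp V.2.fromSpec π (V.2.primeIdealOf ⟨y, hy⟩) h2
    have hy' : V.2.fromSpec (V.2.primeIdealOf ⟨y, hy⟩) = y := V.2.fromSpec_primeIdealOf ⟨y, hy⟩
    rw [hy'] at h3
    exact h3

end Blowup

end Literature.AlgebraicGeometry.Motives

end
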